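import Literature.MathematicalPhysics.QuantumFieldTheory.Balaban1983to89.Node00.CarriersB13
import Summits.QuantumFields.YangMills.Theorems.BalabanUVNodesN10AtRecord11

/-!
# BalabanUVNodes ∕ N10 AT NODE 00's [B13] GROUP OF RECORD — THE JUNCTION: [Balaban1988RG2Cluster] Lemmas 1–2 knit FROM THEIR LOCATED INPUTS at the
# two-scale torus step of record `Node00.WtOfRecord θ lam` ∕ constants `Node00.c13OfRecord θ lam` (`Node00/CarriersB13`, p457685), Lemma 3 carried as the
# located FLAG hypothesis (resp. at LEVEL T from (2.26) per term); the pin at ₁₁ and the `S_N10` shape of the presented record class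
# (Track A, DAG node N10 [B13]; strategy s2 «by-name knit ∕ reduction at the ₁₁ record»; seat `pub-ymgap-dag-n10-d`; companion of `…N10AtRecord11` p451777)

HONEST FRAMING.  Count-neutral kernel bookkeeping over LANDED modules: NODE 00's `CarriersB13` (the residual [B13] term layer `ResidB13 θ`, the step of record
`WtOfRecord θ lam : TwoTorusStep 4 (θ.ℓ₆+1) (lam.n+1)` with its `rfl` faces, `c13OfRecord`, `B13LeafOfRecord`, the Stage-11 pin `pinB13`, the seven-pin view
`view₁₁B13B12B8B10YZW`, the record `IsRecordOfRecord₁₁CB10YZWB8B12B13`), dag-p2's `B13NodeTorusTermwise` (`lemma12_twoTorus`, `b13Leaf_twoTorus_termwise`, p411918),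
`B13NodeKnitRecord5C`, g31's `Record11Carriers` (`rebindX`) and this seat's `…N10AtRecord11` (`b13_main_rebindX_of_leaf`).  N10 is NOT discharged: the located
per-term inputs of Lemmas 1–2 (and, at LEVEL T, (2.26) per term + the numbers; else the Lemma-3 FLAG) are HYPOTHESES ABOUT THE HIDDEN RESIDUAL LAYER `lam`
— print's located input displayed, not proved — and NODE A's content (Lemma 3 ∕ (2.26): [13] Thm 3.10∕3.12 for Bałaban's kernels) is owned elsewhere (N06 s4,
dag-n10-c's walks currency).  Over the record class `IsRecordOfRecord₁₁CB10YZWB8B12B13` itself NO ∀-form of N10 is claimed (the layer is free data there: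
`Node00.exists_residB13_not_b13LeafOfRecord`, cited, not redeclared); §3 states the `S_N10` shape only for record predicates PRESENTED WITH THE LEAF.
Everything here is MODULO THE DISPLAYED NON-DEGENERACY DATA of the layer (def-B13's A2-ANSWER): the pin does not by itself exclude the degenerate step —
with EMPTY spaces `lam.sp1 = lam.sp2 = ∅` the leaf, and every located input below quantified over `φ ∈ lam.sp1 Y`, holds VACUOUSLY
(`Node00.exists_residB13_b13LeafOfRecord`); a contentful reading needs the spaces non-empty and `lam.Restr` ∕ `lam.GaugeInv` the located sentences, which is
the successor LAW layer's ∕ an «inhabited-at» audit's affair, not this file's.  Nothing of Bałaban's is asserted; no node count moves; one finite four-torus programme at fixed ε per run; nothing continuum ∕ ℝ⁴ ∕ OS ∕ mass-gap ∕ Clay.  0 `sorry`, 0 `def`, standard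
axioms.  Filed `--supports` K1 «StabilityBAtRecordR11e» (stmt-QuantumFields-19674) of route «BalabanUVNodes» (director-ym LINE №68).

THE JUNCTION (what NODE 00's definer deferred to the consumer: «the 60-binder junction theorem is NOT typed in this module (one `exact b13Leaf_twoTorus_termwise
…` in the consumer's module)»).  At Stage-3 parameters `θ` and a layer `lam : ResidB13 θ` every IDENTIFICATION binder of the torus closers is a face of
`CarriersB13` BY NAME — the (1.33) index families and terms ARE the layer's, V′_k ∕ V″_k ∕ V_k ∕ Q ∕ rd ∕ M⁻⁴|Y| ∕ H are the displayed sums (`WtOfRecord_Vp ∕ _Vpp ∕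
_V ∕ _Q ∕ _rd`, `rfl`, `termDomination_WtOfRecord`), `Analytic := AnalyticOnNhd ℂ` is closed under `+` and contains `0` (`ResidB13.analytic_add ∕ _zero`), `c.L =
L` is `rfl`, `L > 1` is `Stage3Params.hL'` — so the closers apply with ONLY print's located input left displayed (§1).  §2 reads N10 at a run bound at the
seven-pin view (S-binding) ∕ at the C-binding of the [B13]-pinned Stage-11 view from the leaf at the layer of record; §3 is the `S_N10 Rec` shape for every
record predicate presented at the seven-pin view WITH the leaf at every run — what a LAW-layer (or `TermTowerOfRecord`-keyed) successor record instantiates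
with §1 as the leaf's proof.

WHAT THIS FILE PROVES.  §1 `b13LeafOfRecord_of_located` (Lemmas 1–2 from located inputs, Lemma 3 the FLAG), `b13LeafOfRecord_of_located_termwise` (LEVEL T:
all three lemmas from located inputs, (2.26) per term + `Lemma3Numerics` + `8 ≤ L`); §2 `b13_main_at_view₁₁B13_of_leafOfRecord`, `b13_main_at_pinB13_of_leafOfRecord`;
§3 `s_N10_of_presentedB13`.
-/

noncomputable section

namespace Summit.QuantumFields.YangMills.BalabanUVNodes.N10AtRecord11B13

open Literature.MathematicalPhysics.QuantumFieldTheory.Balaban1983to89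
open Literature.MathematicalPhysics.QuantumFieldTheory.Balaban1983to89.T4Continuum
open Literature.MathematicalPhysics.QuantumFieldTheory.Balaban1983to89.DagBinding
open Literature.MathematicalPhysics.QuantumFieldTheory.Balaban1983to89.Node00
open Literature.MathematicalPhysics.QuantumFieldTheory.Balaban1983to89.B13Lemma3Torus (TwoTorusStep)
open Literature.MathematicalPhysics.QuantumFieldTheory.Balaban1983to89.B13Lemma3TorusSocket (TermDomination Termwise226 Lemma3Numerics)
open Metric
open Literature.MathematicalPhysics.QuantumFieldTheory.Balaban1983to89.B16Absorption (pbox)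
open Literature.MathematicalPhysics.QuantumFieldTheory.Balaban1983to89.TreeLengthTorus
open Literature.MathematicalPhysics.QuantumFieldTheory.Balaban1983to89.TreeLengthTorusTransfer (tcoarse)
open Literature.MathematicalPhysics.QuantumFieldTheory.Balaban1983to89.B12TreeDecay (kappa₀ K₀)
open Literature.MathematicalPhysics.QuantumFieldTheory.Balaban1983to89.B13PkScaling (Qop scaled)
open Literature.MathematicalPhysics.QuantumFieldTheory.Balaban1983to89.B13NodeTorusTermwise (lemma12_twoTorus b13Leaf_twoTorus_termwise)
open YMDAG.UVSplit (RecordPred S_N10)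
open Summit.QuantumFields.YangMills.BalabanUVNodes.N10AtRecord11 (b13_main_rebindX_of_leaf)

/-! ## §1. THE JUNCTION AT THE GROUP OF RECORD: `B13LeafOfRecord θ lam` from the located inputs at NODE 00's objects (Stage 3) -/

section Group

variable (θ : Stage3Params) (lam : ResidB13 θ)

set_option maxSynthPendingDepth 3 in
/-- **THE [B13] LEAF AT NODE 00's GROUP OF RECORD — LEMMAS 1–2 KNIT FROM THEIR LOCATED PER-TERM INPUTS AT THE OBJECTS OF RECORD, LEMMA 3 THE LOCATED FLAG.**
At Stage-3 parameters `θ` (block size `L = θ.ℓ₆ + 1`, `Stage3Params.hℓ₆`) and a residual [B13] term layer `lam : ResidB13 θ`, the step of record is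
`WtOfRecord θ lam : TwoTorusStep 4 (θ.ℓ₆ + 1) (lam.n + 1)` and the constants of record `c13OfRecord θ lam = {lam.c with L := θ.ℓ₆ + 1}` (`Node00/CarriersB13`).
This is `B13NodeTorusTermwise.lemma12_twoTorus` (p411918) AT THOSE OBJECTS with every IDENTIFICATION binder DISCHARGED BY NAME: the (1.33) index families and
terms ARE the layer's (`S0 F Sq SX T Sc Sq' SX' T'`), `h133 := WtOfRecord_Vp` (V′_k IS the double sum of its terms), `hVpp := WtOfRecord_Vpp` (V″_k = V′_k + the
curvature terms `lam.Gl`), `hrd := WtOfRecord_rd`, `hV := WtOfRecord_V`, `hQ := WtOfRecord_Q`, `hvolk := rfl` (M⁻⁴|Y| = #Y), `hAdd ∕ hZero := ResidB13.analytic_add ∕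
analytic_zero` (`Analytic := AnalyticOnNhd ℂ`), `hL2 := Stage3Params.hL'` (L > 1).  What REMAINS displayed is exactly print's located input: LEMMA 1 (pp. 7–9) —
the fine torus has ≥ 12 cubes per direction, [I]'s block geometry of the index families (`hS0Y hFsub hSq hScY hSX hSX' hX0`, the distance reading `dist`),
per-term analyticity on (1.34), the thresholds and R8∕R9 on the residual constants `lam.c`, per-term (1.24)∕(1.30) BY REFERENCE to [I] (3.54), (3.17), [15]
Prop. 4, [13] (3.108) (`h124`, `h130` — where the in-edges' content enters), the choice `hC` of C₁, C₂, q with headroom `(1 − ϑ)`; LEMMA 2 (pp. 10–11) — the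
curvature terms analytic and (1.36)-small at prefactor ϑ, `‖e_{Y,b}‖ ≤ 1`, `g_k ≠ 0`, the (1.38)∕(1.39) data of the scaled cubic terms, `#(s Y) ≤ m₂·#Y`,
(1.34) in coordinates, the floor, per-term analyticity, gauge invariance by assertion (cell GAPS G-B13-06); LEMMA 3 (p. 20) — THE FLAG `h3`, NODE A's
content, displayed, NOT proved here.  CONCLUSION: `B13LeafOfRecord θ lam` (Lemma 1 ∧ Lemma 2 ∧ Lemma 3 AS PRINTED at the group of record).  Count-neutral:
the inputs are hypotheses about the HIDDEN residual layer; nothing of Bałaban's is asserted. [cite: Balaban1988RG2Cluster, Lemma 1 p.9, Lemma 2 p.11, Lemma 3 p.20] -/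
theorem b13LeafOfRecord_of_located
    (hN12 : 12 ≤ (θ.ℓ₆ + 1) * (lam.n + 1))
    -- (1) LEMMA 1: [I]'s block geometry of the (1.33) index families of the layer
    (dist : TDom 4 ((θ.ℓ₆ + 1) * (lam.n + 1)) → TPt 4 ((θ.ℓ₆ + 1) * (lam.n + 1)) → (j : ℕ) →
      TPt 4 ((θ.ℓ₆ + 1) ^ (lam.k - j) * ((θ.ℓ₆ + 1) * (lam.n + 1))) → ℝ) {K K' : ℝ}
    (hS0Y : ∀ Y, ∀ a ∈ lam.S0 Y,
      (pbox (fun i => natLift a i - (5 : ℕ)) (fun i => natLift a i + 1 + (5 : ℕ))).image (proj ((θ.ℓ₆ + 1) * (lam.n + 1))) ⊆ Y.1)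
    (hFsub : ∀ Y a, lam.F Y a ⊆
      (pbox (fun i => natLift a i - (5 : ℕ)) (fun i => natLift a i + 1 + (5 : ℕ))).image (proj ((θ.ℓ₆ + 1) * (lam.n + 1))) \
        (pbox (fun i => natLift a i - (4 : ℕ)) (fun i => natLift a i + 1 + (4 : ℕ))).image (proj ((θ.ℓ₆ + 1) * (lam.n + 1))))
    (hSq : ∀ Y, ∀ a ∈ lam.S0 Y, ∀ j, lam.Sq Y a j ⊆
      (Finset.univ : Finset (TPt 4 ((θ.ℓ₆ + 1) ^ (lam.k - j) * ((θ.ℓ₆ + 1) * (lam.n + 1))))).filter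
        (fun q => tcoarse ((θ.ℓ₆ + 1) ^ (lam.k - j)) ((θ.ℓ₆ + 1) * (lam.n + 1)) q ∈
          (pbox (fun i => natLift a i - (2 : ℕ)) (fun i => natLift a i + 1 + (2 : ℕ))).image (proj ((θ.ℓ₆ + 1) * (lam.n + 1)))))
    (hScY : ∀ Y, lam.Sc Y ⊆ Y.1)
    (hdist0 : ∀ Y a j q, 0 ≤ lam.c.δ₀ * dist Y a j q)
    (hdist : ∀ Y a j (n : ℕ) q, q ∉ (pbox (fun i => (((θ.ℓ₆ + 1) ^ (lam.k - j) : ℕ) : ℤ) * natLift a i - (n + 1 : ℕ))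
      (fun i => (((θ.ℓ₆ + 1) ^ (lam.k - j) : ℕ) : ℤ) * natLift a i + 2 * (((θ.ℓ₆ + 1) ^ (lam.k - j) : ℕ) : ℤ) - 1 + (n + 1 : ℕ))).image
        (proj ((θ.ℓ₆ + 1) ^ (lam.k - j) * ((θ.ℓ₆ + 1) * (lam.n + 1)))) → lam.c.δ₀ * lam.c.M * ((n : ℝ) + 1) ≤ lam.c.δ₀ * dist Y a j q)
    (hSX : ∀ Y a j q, lam.SX Y a j q ⊆ (tcubeSys 4 ((θ.ℓ₆ + 1) ^ (lam.k - j) * ((θ.ℓ₆ + 1) * (lam.n + 1)))).above q)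
    (hSX' : ∀ Y a j q, lam.SX' Y a j q ⊆ (tcubeSys 4 ((θ.ℓ₆ + 1) ^ (lam.k - j) * ((θ.ℓ₆ + 1) * (lam.n + 1)))).above q)
    (hX0 : ∀ Y, ∀ a ∈ lam.Sc Y, ∀ j ∈ Finset.range (lam.k + 1), ∀ q ∈ lam.Sq' Y a j, ∀ x ∈ lam.SX' Y a j q,
      x.1.image (tcoarse ((θ.ℓ₆ + 1) ^ (lam.k - j)) ((θ.ℓ₆ + 1) * (lam.n + 1))) ⊆ Y.1)
    -- (1) LEMMA 1: per-term analyticity on (1.34)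
    (hAnT : ∀ Y, ∀ a ∈ lam.S0 Y, ∀ X ∈ (lam.F Y a).powerset, ∀ j ∈ Finset.range (lam.k + 1), ∀ q ∈ lam.Sq Y a j,
      ∀ x ∈ lam.SX Y a j q, AnalyticOnNhd ℂ (lam.T Y a X j q x) (lam.sp1 Y))
    (hAnT' : ∀ Y, ∀ a ∈ lam.Sc Y, ∀ j ∈ Finset.range (lam.k + 1), ∀ q ∈ lam.Sq' Y a j, ∀ x ∈ lam.SX' Y a j q,
      AnalyticOnNhd ℂ (lam.T' Y a j q x) (lam.sp1 Y))
    -- (1) LEMMA 1: thresholds and restrictions on the residual constants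
    (hK : 0 ≤ K) (hK' : 0 ≤ K') (hκ : 0 ≤ lam.c.κ) (hδ1 : lam.c.δ < 1) (hδκ : 1 ≤ lam.c.δ * lam.c.κ)
    (hκ126 : kappa₀ 64 8 ≤ lam.c.κ) (hκ126' : kappa₀ 64 8 ≤ lam.c.δ * lam.c.κ)
    (hκ₁ : 1 + 2 * Real.log (8 * 12 ^ 3) ≤ lam.c.κ₁) (hκ₁' : 2 + 16 * Real.log 128 ≤ lam.c.κ₁)
    (hδ₀M : 10 * Real.exp (-1) ≤ lam.c.δ₀ * lam.c.M) (hδ₀M5 : 2 * Real.log 5 ≤ lam.c.δ₀ * lam.c.M)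
    (hR8 : (1 - lam.c.δ) * lam.c.κ ≤ (1 / 4) * (lam.c.κ₁ - 1)) (hR9 : (1 - 2 * lam.c.δ) * lam.c.κ ≤ (1 / 16) * lam.c.κ₁)
    -- (1) LEMMA 1: per-term (1.24), (1.30) by reference to [I] (3.54), (3.17), [15] Prop. 4, [13] (3.108); the constants with headroom (1 − ϑ)
    (h124 : ∀ Y φ, φ ∈ lam.sp1 Y → ∀ a ∈ lam.S0 Y, ∀ X ∈ (lam.F Y a).powerset, ∀ j ∈ Finset.range (lam.k + 1), ∀ q ∈ lam.Sq Y a j,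
      ∀ x ∈ lam.SX Y a j q,
        ‖lam.T Y a X j q x φ‖ ≤ K * (((θ.ℓ₆ + 1 : ℕ) : ℝ) ^ j * (((θ.ℓ₆ + 1 : ℕ) : ℝ) ^ lam.k)⁻¹) ^ 5 *
          Real.exp (-(lam.c.κ₁ - 1) *
            (((Y.1 \ (pbox (fun i => natLift a i - (5 : ℕ)) (fun i => natLift a i + 1 + (5 : ℕ))).image
              (proj ((θ.ℓ₆ + 1) * (lam.n + 1)))).card : ℝ) + X.card)) *
          Real.exp (-(lam.c.κ * torusTreeLen x.1)))
    (h130 : ∀ Y φ, φ ∈ lam.sp1 Y → ∀ a ∈ lam.Sc Y, ∀ j ∈ Finset.range (lam.k + 1), ∀ q ∈ lam.Sq' Y a j,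
      ∀ x ∈ lam.SX' Y a j q,
        ‖lam.T' Y a j q x φ‖ ≤ K' * Real.exp (-(1 / 2) * (lam.c.δ₀ * lam.c.M) * (((θ.ℓ₆ + 1 : ℕ) : ℝ) ^ j * (((θ.ℓ₆ + 1 : ℕ) : ℝ) ^ lam.k)⁻¹)⁻¹
            - (1 / 2) * lam.c.δ₀ * dist Y a j q) *
          Real.exp (-(lam.c.κ₁ - 1) * ((Y.1 \ x.1.image (tcoarse ((θ.ℓ₆ + 1) ^ (lam.k - j)) ((θ.ℓ₆ + 1) * (lam.n + 1)))).card : ℝ)) *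
          Real.exp (-(lam.c.κ * torusTreeLen x.1)))
    {ϑ : ℝ} (hϑ0 : 0 ≤ ϑ) (hϑ1 : ϑ < 1)
    (hC : K * K₀ 64 8 * (2 * (6 * ((θ.ℓ₆ + 1 : ℕ) : ℝ)) ^ 4) * Real.exp 1 * Real.exp ((1 / 8) * lam.c.κ₁ * (12 ^ 4 - 1)) +
        2 * (64 * K') * K₀ 64 8 * 1344 ≤
      (1 - ϑ) * (lam.c.E₀ * lam.c.ε₁ * lam.c.C₁ * lam.c.M ^ lam.c.q * Real.exp (lam.c.C₂ * lam.c.κ₁)))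
    -- (2) LEMMA 2 (pp. 10–11): the curvature terms; the located per-term data of `B13Lemma2Torus.lemma2Printed_twoTorus'` for the layer's plaquette data
    (hGlAn : ∀ Y, AnalyticOnNhd ℂ (lam.Gl Y) (lam.sp1 Y))
    (hGl : ∀ Y φ, φ ∈ lam.sp1 Y → ‖lam.Gl Y φ‖ ≤ ϑ * (lam.c.E₀ * lam.c.ε₁ * lam.c.C₁ * lam.c.M ^ lam.c.q * Real.exp (lam.c.C₂ * lam.c.κ₁)) *
      Real.exp (-((1 - 2 * lam.c.δ) * lam.c.κ * (tsys 4 ((θ.ℓ₆ + 1) * (lam.n + 1))).dj Y)))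
    (he : ∀ Y b, ‖lam.e Y b‖ ≤ 1) (hg : lam.g ≠ 0)
    {R K₂ : ℝ} {m₂ : ℕ} (hK₂ : 0 ≤ K₂) (hR : 0 < R) (hε3 : 3 * lam.c.ε₁ ≤ R)
    (hW : ∀ Y, ∀ i ∈ lam.s Y, ∀ φ ∈ lam.sp1 Y, AnalyticOnNhd ℂ (lam.Wf Y i φ) (ball 0 R))
    (hKW : ∀ Y, ∀ i ∈ lam.s Y, ∀ φ ∈ lam.sp1 Y, ∀ z ∈ ball (0 : lam.E) R,
      ‖lam.Wf Y i φ z‖ ≤ K₂ * Real.exp (-(lam.c.κ₁ - 1) * ((Y.1.card : ℝ) - 1)) * ‖z‖ ^ 3)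
    (hcard : ∀ Y, (lam.s Y).card ≤ m₂ * Y.1.card)
    (hsp : ∀ Y φ, φ ∈ lam.sp1 Y → ‖lam.g‖ * ‖lam.rd Y φ‖ < lam.c.ε₁)
    (hfloor : 27 * m₂ * K₂ * Real.exp (lam.c.κ₁ - 1) ≤ lam.c.C₃ * lam.c.M ^ 4 * Real.exp (lam.c.C₂ * lam.c.κ₁))
    (hAnP : ∀ Y, ∀ i ∈ lam.s Y, AnalyticOnNhd ℂ (fun φ => scaled lam.g (lam.Wf Y i φ) (lam.rd Y φ)) (lam.sp1 Y))
    (hG : ∀ Y, lam.GaugeInv (lam.V Y) ∧ lam.GaugeInv ((WtOfRecord θ lam).toStepData.quadForm Y) ∧ lam.GaugeInv (lam.Vpp Y))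
    -- (3) LEMMA 3 (p. 20): THE LOCATED FLAG — NODE A's content, displayed
    (h3 : B13.Lemma3Printed (WtOfRecord θ lam).toStepData (c13OfRecord θ lam)) :
    B13LeafOfRecord θ lam :=
  have h12 := lemma12_twoTorus (WtOfRecord θ lam) (c13OfRecord θ lam) lam.k hN12 θ.hL'.2 lam.S0 lam.F lam.Sq lam.SX lam.T
    lam.Sc lam.Sq' lam.SX' lam.T' dist (WtOfRecord_Vp lam) hS0Y hFsub hSq hScY hdist0 hdist hSX hSX' hX0
    (fun _ _ _ hf hg => lam.analytic_add hf hg) lam.analytic_zero hAnT hAnT' hK hK' hκ hδ1 hδκ hκ126 hκ126' hκ₁ hκ₁' hδ₀M hδ₀M5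
    hR8 hR9 h124 h130 hϑ0 hϑ1 hC lam.Gl (WtOfRecord_Vpp lam) hGlAn hGl lam.rd lam.e he (WtOfRecord_rd lam) lam.s lam.Wf hg hK₂ hR
    hε3 hW hKW hcard (WtOfRecord_V lam) (fun Y φ b b' _ => WtOfRecord_Q lam Y φ b b') hsp (fun _ => rfl) hfloor hAnP hG
  ⟨h12.1, h12.2, h3⟩

set_option maxSynthPendingDepth 3 in
/-- **THE [B13] LEAF AT NODE 00's GROUP OF RECORD AT LEVEL T — ALL THREE LEMMAS FROM LOCATED INPUTS, NO FLAG.**  The Lemma 1–2 inputs of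
`b13LeafOfRecord_of_located` and, for LEMMA 3 (pp. 14–20) at LEVEL T of `B13Lemma3TorusSocket` (`B13NodeTorusTermwise.b13Leaf_twoTorus_termwise`, p411918,
applied BY NAME at the objects of record): H(Z) IS the sum of its terms `lam.T₃` over the torus term set (𝐃, P) — so termwise domination `hH` is the THEOREM
`termDomination_WtOfRecord` (discharged), `hLc := rfl` (`c13OfRecord_L`) — and what remains displayed is (2.26) PER TERM (`h226`, the (2.26)-majorant of every
term of (2.9)∕(2.14): NODE A's content in the termwise currency, where [13] Thm 3.10∕3.12 enter) and the bundle `hN` of print's restrictions on the constants at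
ℓ = ½L with `8 ≤ L` (`hL8`; `L = θ.ℓ₆ + 1 = θ.L`).  CONCLUSION: `B13LeafOfRecord θ lam`.  ((2.38) currency instead: feed `b13LeafOfRecord_of_located` with
`h3 := B13LeafTorus.lemma3_conjunct_twoTorus (WtOfRecord θ lam) (c13OfRecord θ lam) h238`.)  Count-neutral: hypotheses about the HIDDEN residual layer.
[cite: Balaban1988RG2Cluster, Lemma 1 p.9, Lemma 2 p.11, Lemma 3 p.20, (2.26) p.17, (2.38) p.20] -/
theorem b13LeafOfRecord_of_located_termwise
    (hN12 : 12 ≤ (θ.ℓ₆ + 1) * (lam.n + 1))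
    -- (1) LEMMA 1: [I]'s block geometry of the (1.33) index families of the layer
    (dist : TDom 4 ((θ.ℓ₆ + 1) * (lam.n + 1)) → TPt 4 ((θ.ℓ₆ + 1) * (lam.n + 1)) → (j : ℕ) →
      TPt 4 ((θ.ℓ₆ + 1) ^ (lam.k - j) * ((θ.ℓ₆ + 1) * (lam.n + 1))) → ℝ) {K K' : ℝ}
    (hS0Y : ∀ Y, ∀ a ∈ lam.S0 Y,
      (pbox (fun i => natLift a i - (5 : ℕ)) (fun i => natLift a i + 1 + (5 : ℕ))).image (proj ((θ.ℓ₆ + 1) * (lam.n + 1))) ⊆ Y.1)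
    (hFsub : ∀ Y a, lam.F Y a ⊆
      (pbox (fun i => natLift a i - (5 : ℕ)) (fun i => natLift a i + 1 + (5 : ℕ))).image (proj ((θ.ℓ₆ + 1) * (lam.n + 1))) \
        (pbox (fun i => natLift a i - (4 : ℕ)) (fun i => natLift a i + 1 + (4 : ℕ))).image (proj ((θ.ℓ₆ + 1) * (lam.n + 1))))
    (hSq : ∀ Y, ∀ a ∈ lam.S0 Y, ∀ j, lam.Sq Y a j ⊆
      (Finset.univ : Finset (TPt 4 ((θ.ℓ₆ + 1) ^ (lam.k - j) * ((θ.ℓ₆ + 1) * (lam.n + 1))))).filter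
        (fun q => tcoarse ((θ.ℓ₆ + 1) ^ (lam.k - j)) ((θ.ℓ₆ + 1) * (lam.n + 1)) q ∈
          (pbox (fun i => natLift a i - (2 : ℕ)) (fun i => natLift a i + 1 + (2 : ℕ))).image (proj ((θ.ℓ₆ + 1) * (lam.n + 1)))))
    (hScY : ∀ Y, lam.Sc Y ⊆ Y.1)
    (hdist0 : ∀ Y a j q, 0 ≤ lam.c.δ₀ * dist Y a j q)
    (hdist : ∀ Y a j (n : ℕ) q, q ∉ (pbox (fun i => (((θ.ℓ₆ + 1) ^ (lam.k - j) : ℕ) : ℤ) * natLift a i - (n + 1 : ℕ))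
      (fun i => (((θ.ℓ₆ + 1) ^ (lam.k - j) : ℕ) : ℤ) * natLift a i + 2 * (((θ.ℓ₆ + 1) ^ (lam.k - j) : ℕ) : ℤ) - 1 + (n + 1 : ℕ))).image
        (proj ((θ.ℓ₆ + 1) ^ (lam.k - j) * ((θ.ℓ₆ + 1) * (lam.n + 1)))) → lam.c.δ₀ * lam.c.M * ((n : ℝ) + 1) ≤ lam.c.δ₀ * dist Y a j q)
    (hSX : ∀ Y a j q, lam.SX Y a j q ⊆ (tcubeSys 4 ((θ.ℓ₆ + 1) ^ (lam.k - j) * ((θ.ℓ₆ + 1) * (lam.n + 1)))).above q)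
    (hSX' : ∀ Y a j q, lam.SX' Y a j q ⊆ (tcubeSys 4 ((θ.ℓ₆ + 1) ^ (lam.k - j) * ((θ.ℓ₆ + 1) * (lam.n + 1)))).above q)
    (hX0 : ∀ Y, ∀ a ∈ lam.Sc Y, ∀ j ∈ Finset.range (lam.k + 1), ∀ q ∈ lam.Sq' Y a j, ∀ x ∈ lam.SX' Y a j q,
      x.1.image (tcoarse ((θ.ℓ₆ + 1) ^ (lam.k - j)) ((θ.ℓ₆ + 1) * (lam.n + 1))) ⊆ Y.1)
    -- (1) LEMMA 1: per-term analyticity on (1.34)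
    (hAnT : ∀ Y, ∀ a ∈ lam.S0 Y, ∀ X ∈ (lam.F Y a).powerset, ∀ j ∈ Finset.range (lam.k + 1), ∀ q ∈ lam.Sq Y a j,
      ∀ x ∈ lam.SX Y a j q, AnalyticOnNhd ℂ (lam.T Y a X j q x) (lam.sp1 Y))
    (hAnT' : ∀ Y, ∀ a ∈ lam.Sc Y, ∀ j ∈ Finset.range (lam.k + 1), ∀ q ∈ lam.Sq' Y a j, ∀ x ∈ lam.SX' Y a j q,
      AnalyticOnNhd ℂ (lam.T' Y a j q x) (lam.sp1 Y))
    -- (1) LEMMA 1: thresholds and restrictions on the residual constants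
    (hK : 0 ≤ K) (hK' : 0 ≤ K') (hκ : 0 ≤ lam.c.κ) (hδ1 : lam.c.δ < 1) (hδκ : 1 ≤ lam.c.δ * lam.c.κ)
    (hκ126 : kappa₀ 64 8 ≤ lam.c.κ) (hκ126' : kappa₀ 64 8 ≤ lam.c.δ * lam.c.κ)
    (hκ₁ : 1 + 2 * Real.log (8 * 12 ^ 3) ≤ lam.c.κ₁) (hκ₁' : 2 + 16 * Real.log 128 ≤ lam.c.κ₁)
    (hδ₀M : 10 * Real.exp (-1) ≤ lam.c.δ₀ * lam.c.M) (hδ₀M5 : 2 * Real.log 5 ≤ lam.c.δ₀ * lam.c.M)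
    (hR8 : (1 - lam.c.δ) * lam.c.κ ≤ (1 / 4) * (lam.c.κ₁ - 1)) (hR9 : (1 - 2 * lam.c.δ) * lam.c.κ ≤ (1 / 16) * lam.c.κ₁)
    -- (1) LEMMA 1: per-term (1.24), (1.30) by reference to [I] (3.54), (3.17), [15] Prop. 4, [13] (3.108); the constants with headroom (1 − ϑ)
    (h124 : ∀ Y φ, φ ∈ lam.sp1 Y → ∀ a ∈ lam.S0 Y, ∀ X ∈ (lam.F Y a).powerset, ∀ j ∈ Finset.range (lam.k + 1), ∀ q ∈ lam.Sq Y a j,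
      ∀ x ∈ lam.SX Y a j q,
        ‖lam.T Y a X j q x φ‖ ≤ K * (((θ.ℓ₆ + 1 : ℕ) : ℝ) ^ j * (((θ.ℓ₆ + 1 : ℕ) : ℝ) ^ lam.k)⁻¹) ^ 5 *
          Real.exp (-(lam.c.κ₁ - 1) *
            (((Y.1 \ (pbox (fun i => natLift a i - (5 : ℕ)) (fun i => natLift a i + 1 + (5 : ℕ))).image
              (proj ((θ.ℓ₆ + 1) * (lam.n + 1)))).card : ℝ) + X.card)) *
          Real.exp (-(lam.c.κ * torusTreeLen x.1)))
    (h130 : ∀ Y φ, φ ∈ lam.sp1 Y → ∀ a ∈ lam.Sc Y, ∀ j ∈ Finset.range (lam.k + 1), ∀ q ∈ lam.Sq' Y a j,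
      ∀ x ∈ lam.SX' Y a j q,
        ‖lam.T' Y a j q x φ‖ ≤ K' * Real.exp (-(1 / 2) * (lam.c.δ₀ * lam.c.M) * (((θ.ℓ₆ + 1 : ℕ) : ℝ) ^ j * (((θ.ℓ₆ + 1 : ℕ) : ℝ) ^ lam.k)⁻¹)⁻¹
            - (1 / 2) * lam.c.δ₀ * dist Y a j q) *
          Real.exp (-(lam.c.κ₁ - 1) * ((Y.1 \ x.1.image (tcoarse ((θ.ℓ₆ + 1) ^ (lam.k - j)) ((θ.ℓ₆ + 1) * (lam.n + 1)))).card : ℝ)) *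
          Real.exp (-(lam.c.κ * torusTreeLen x.1)))
    {ϑ : ℝ} (hϑ0 : 0 ≤ ϑ) (hϑ1 : ϑ < 1)
    (hC : K * K₀ 64 8 * (2 * (6 * ((θ.ℓ₆ + 1 : ℕ) : ℝ)) ^ 4) * Real.exp 1 * Real.exp ((1 / 8) * lam.c.κ₁ * (12 ^ 4 - 1)) +
        2 * (64 * K') * K₀ 64 8 * 1344 ≤
      (1 - ϑ) * (lam.c.E₀ * lam.c.ε₁ * lam.c.C₁ * lam.c.M ^ lam.c.q * Real.exp (lam.c.C₂ * lam.c.κ₁)))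
    -- (2) LEMMA 2 (pp. 10–11): the curvature terms; the located per-term data of `B13Lemma2Torus.lemma2Printed_twoTorus'` for the layer's plaquette data
    (hGlAn : ∀ Y, AnalyticOnNhd ℂ (lam.Gl Y) (lam.sp1 Y))
    (hGl : ∀ Y φ, φ ∈ lam.sp1 Y → ‖lam.Gl Y φ‖ ≤ ϑ * (lam.c.E₀ * lam.c.ε₁ * lam.c.C₁ * lam.c.M ^ lam.c.q * Real.exp (lam.c.C₂ * lam.c.κ₁)) *
      Real.exp (-((1 - 2 * lam.c.δ) * lam.c.κ * (tsys 4 ((θ.ℓ₆ + 1) * (lam.n + 1))).dj Y)))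
    (he : ∀ Y b, ‖lam.e Y b‖ ≤ 1) (hg : lam.g ≠ 0)
    {R K₂ : ℝ} {m₂ : ℕ} (hK₂ : 0 ≤ K₂) (hR : 0 < R) (hε3 : 3 * lam.c.ε₁ ≤ R)
    (hW : ∀ Y, ∀ i ∈ lam.s Y, ∀ φ ∈ lam.sp1 Y, AnalyticOnNhd ℂ (lam.Wf Y i φ) (ball 0 R))
    (hKW : ∀ Y, ∀ i ∈ lam.s Y, ∀ φ ∈ lam.sp1 Y, ∀ z ∈ ball (0 : lam.E) R,
      ‖lam.Wf Y i φ z‖ ≤ K₂ * Real.exp (-(lam.c.κ₁ - 1) * ((Y.1.card : ℝ) - 1)) * ‖z‖ ^ 3)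
    (hcard : ∀ Y, (lam.s Y).card ≤ m₂ * Y.1.card)
    (hsp : ∀ Y φ, φ ∈ lam.sp1 Y → ‖lam.g‖ * ‖lam.rd Y φ‖ < lam.c.ε₁)
    (hfloor : 27 * m₂ * K₂ * Real.exp (lam.c.κ₁ - 1) ≤ lam.c.C₃ * lam.c.M ^ 4 * Real.exp (lam.c.C₂ * lam.c.κ₁))
    (hAnP : ∀ Y, ∀ i ∈ lam.s Y, AnalyticOnNhd ℂ (fun φ => scaled lam.g (lam.Wf Y i φ) (lam.rd Y φ)) (lam.sp1 Y))
    (hG : ∀ Y, lam.GaugeInv (lam.V Y) ∧ lam.GaugeInv ((WtOfRecord θ lam).toStepData.quadForm Y) ∧ lam.GaugeInv (lam.Vpp Y))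
    -- (3) LEMMA 3 (pp. 14–20) at LEVEL T: (2.26) per term of H(Z) = Σ_{(𝐃,P)} T₃, the printed restrictions on the constants at ℓ = ½L, L ≥ 8
    (hL8 : 8 ≤ θ.ℓ₆ + 1) {a a₂ a₂' a₅ Aabs : ℝ} (h226 : Termwise226 (c13OfRecord θ lam) a a₅ (WtOfRecord θ lam) lam.T₃)
    (hN : Lemma3Numerics (c13OfRecord θ lam) (lam.m₃ + 1) (((θ.ℓ₆ + 1 : ℕ) : ℝ) / 2) a a₂ a₂' a₅ Aabs) :
    B13LeafOfRecord θ lam :=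
  b13Leaf_twoTorus_termwise (WtOfRecord θ lam) (c13OfRecord θ lam) lam.k hN12 hL8 rfl lam.S0 lam.F lam.Sq lam.SX lam.T
    lam.Sc lam.Sq' lam.SX' lam.T' dist (WtOfRecord_Vp lam) hS0Y hFsub hSq hScY hdist0 hdist hSX hSX' hX0
    (fun _ _ _ hf hg => lam.analytic_add hf hg) lam.analytic_zero hAnT hAnT' hK hK' hκ hδ1 hδκ hκ126 hκ126' hκ₁ hκ₁' hδ₀M hδ₀M5
    hR8 hR9 h124 h130 hϑ0 hϑ1 hC lam.Gl (WtOfRecord_Vpp lam) hGlAn hGl lam.rd lam.e he (WtOfRecord_rd lam) lam.s lam.Wf hg hK₂ hR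
    hε3 hW hKW hcard (WtOfRecord_V lam) (fun Y φ b b' _ => WtOfRecord_Q lam Y φ b b') hsp (fun _ => rfl) hfloor hAnP hG
    (lam.m₃ + 1) lam.T₃ (termDomination_WtOfRecord lam) h226 hN

end Group

/-! ## §2. The pin at Stage 11: N10 at a run bound at the seven-pin view (S-binding) ∕ at the C-binding of the [B13]-pinned view, from the leaf at the layer of record -/

section Pin

variable (F : T4Family) (N : ℕ) [NeZero N]
variable (θ : Stage11Params F N) (lam13 : B12.RunParams → ResidB13 θ.toStage3Params) (w : WorldP) (P : B12.RunParams)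

/-- **N10 AT A RUN BOUND TO THE S-BINDING AT NODE 00's SEVEN-PIN STAGE-11 VIEW, FROM THE LEAF AT THE LAYER OF RECORD** (the view's `b13` IS
`B13LeafOfRecord θ.toStage3Params (lam13 P)` — `Node00.upOfRecord₅CS_view₁₁B13B12B8B10YZW_b13_iff`, `Iff.rfl`; in-edges unused, as in every torus knit of the
lineage).  With `hleaf := b13LeafOfRecord_of_located …` ∕ `…_termwise …` this is N10 at the run from print's located input.
[cite: Balaban1988RG2Cluster, Lemmas 1–3 pp.9, 11, 20; Balaban1989LargeFieldII, Thm 1 + (0.1) pp.355–356 (the record)] -/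
theorem b13_main_at_view₁₁B13_of_leafOfRecord (lam12 : ResidB12 F N θ.τ9.M) (lam8 : ResidB8 θ.toStage3Params) (Mstar : ℕ)
    (ops : OpsY N θ.toStage3Params Mstar) (ζ : ResidZ F N) (lamW : ResidW F N)
    (hup : w.up P = upOfRecord₅CS F N (θ.view₁₁B13B12B8B10YZW F N lam13 lam12 lam8 Mstar ops ζ lamW) P)
    (hleaf : B13LeafOfRecord θ.toStage3Params (lam13 P)) : Dag.B13_main (leavesP w P) := by
  rw [B13NodeKnitRecord5C.b13_main_iff_up, hup]
  exact fun _ _ _ _ => (upOfRecord₅CS_view₁₁B13B12B8B10YZW_b13_iff F N θ lam13 lam12 lam8 Mstar ops ζ lamW P).2 hleaf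

/-- **N10 AT A RUN BOUND TO THE C-BINDING OF THE [B13]-PINNED STAGE-11 VIEW `(θ.pinB13 lam13).toStage5₁₁`** — which IS the `X`-re-binding
`(θ.toStage5₁₁).rebindX (XB13OfRecord θ.toStage3Params lam13 θ.res.X)` (`Node00.Stage11Params.toStage5₁₁_pinB13`, g31's KERNEL LESSON 7) — FROM THE LEAF AT THE
LAYER OF RECORD (this seat's `b13_main_rebindX_of_leaf`: the re-bound bundle's [B13] group is `((WtOfRecord …).toStepData, c13OfRecord …)` definitionally).
[cite: Balaban1988RG2Cluster, Lemmas 1–3 pp.9, 11, 20] -/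
theorem b13_main_at_pinB13_of_leafOfRecord (hup : w.up P = upOfRecord₅C F N ((θ.pinB13 F N lam13).toStage5₁₁ F N) P)
    (hleaf : B13LeafOfRecord θ.toStage3Params (lam13 P)) : Dag.B13_main (leavesP w P) :=
  b13_main_rebindX_of_leaf F N (θ.toStage5₁₁ F N) (XB13OfRecord θ.toStage3Params lam13 θ.res.X) w P
    (hup.trans (congrArg (upOfRecord₅C F N · P) (Stage11Params.toStage5₁₁_pinB13 F N θ lam13))) hleaf

end Pin

/-! ## §3. The route stub shape `YMDAG.UVSplit.S_N10 Rec` at record predicates PRESENTED at the seven-pin view WITH the leaf at the layer of record -/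

section Stub

variable {N : ℕ} [NeZero N]

/-- **`S_N10 Rec` FOR EVERY RECORD PREDICATE WHOSE WORLDS COME PRESENTED AT NODE 00's SEVEN-PIN STAGE-11 VIEW WITH THE [B13] LEAF AT THE LAYER OF RECORD AT
EVERY RUN** — the shape a successor record instantiates whose law layer makes §1's located inputs THEOREMS about its layer `lam13` (or keys `lam13` to def-T's
term tower of record); over the bare `IsRecordOfRecord₁₁CB10YZWB8B12B13` (layer = free data) no such ∀-form holds (`Node00.exists_residB13_not_b13LeafOfRecord`)
and none is claimed. [cite: Balaban1988RG2Cluster, Lemmas 1–3 pp.9, 11, 20; Balaban1989LargeFieldII, Thm 1 + (0.1) pp.355–356 (the record)] -/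
theorem s_N10_of_presentedB13 (Rec : RecordPred N)
    (hRec : ∀ (F : T4Family) (D : FiniteEpsData F (SU N)) (w : WorldP), Rec F D w →
      ∃ (θ : Stage11Params F N) (lam13 : B12.RunParams → ResidB13 θ.toStage3Params) (lam12 : ResidB12 F N θ.τ9.M) (lam8 : ResidB8 θ.toStage3Params)
        (Mstar : ℕ) (ops : OpsY N θ.toStage3Params Mstar) (ζ : ResidZ F N) (lamW : ResidW F N),
        (∀ P, w.up P = upOfRecord₅CS F N (θ.view₁₁B13B12B8B10YZW F N lam13 lam12 lam8 Mstar ops ζ lamW) P) ∧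
          ∀ P, B13LeafOfRecord θ.toStage3Params (lam13 P)) :
    S_N10 Rec := by
  intro F D w hw P
  obtain ⟨θ, lam13, lam12, lam8, Mstar, ops, ζ, lamW, hup, hleaf⟩ := hRec F D w hw
  exact b13_main_at_view₁₁B13_of_leafOfRecord F N θ lam13 w P lam12 lam8 Mstar ops ζ lamW (hup P) (hleaf P)

end Stub

end Summit.QuantumFields.YangMills.BalabanUVNodes.N10AtRecord11B13

end
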